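import Literature.Algebra.Polynomial.FischerHarmonicNormalForm
import HarnessLib

/-!
# Route `F4SubCurvatureDoor`, crux ⟨stmt-QuantumFields-23125⟩ `RationalToGeneral`: LINE g18-A «SEXTIC CHANNEL» v4
# (planner `ym-idea-3` g18, tree skeleton `Cruxes/RationalToGeneral/Lines/sextic_channel.lean` @38297c29a732) —
# registered stub `stub_fischerNormalForm : FischerNormalForm`, BY NAME AND SIGNATURE, and spelled out

The stub «FISCHER NORMAL FORM» of the skeleton: every real polynomial in four variables is a finite sum
`Σ_m (r²)^{e_m} · H_m` with `H_m` harmonic (`Δ H_m = 0`) and homogeneous (of degree `d_m`).  It is the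
instance `ι = Fin 4` of the Literature theorem
`Literature.Algebra.Polynomial.FischerDecomposition.exists_sum_sq_pow_mul_harmonic` (harmonic Fischer
normal form over any finite index type; Axler–Bourdon–Ramey Thm. 5.7, on top of the tree's graded Fischer
decomposition, Goodman–Wallach Lemma 5.1.5).

Contents:
* `fischerNormalForm_spelled` — the statement with the skeleton's abbreviations `laplacian`,
  `IsHarmonicPoly`, `r2poly` UNFOLDED (definition-free form, consumable by `simpa [IsHarmonicPoly,
  laplacian, r2poly]` from any copy of the skeleton);
* the skeleton's name-keyed definitions `laplacian`, `IsHarmonicPoly`, `r2poly`, `FischerNormalForm` copied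
  VERBATIM into this file's namespace (pattern of `…F4SubCurvatureDoorMirrorAnalyticityRegistered`), and
  the registered stub `theorem stub_fischerNormalForm : FischerNormalForm`.

Mathlib + Literature only; no `sorry`; standard axioms.  HONEST FRAMING: this is the ALGEBRA bookkeeping
stub of an OPEN line — the wall `AnalyticFiniteType` (T1″), `LaplaceFourier` (S1) and `TopChannelCone`
(S2–S7) are untouched; crux 23125 / 23035, rung R2d (`BalabanLadder.ROT`), the route and the summit are NOT
proved; the Yang–Mills mass gap is NOT proved.  Seat `ym-line-frs-p2` g13 (cell ym-idea-3, free hands).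
[cite: AxlerBourdonRamey2001, Thm. 5.7]
-/

set_option autoImplicit false

noncomputable section

namespace Summit.QuantumFields.YangMills.Theorems.F4SubCurvatureDoorFischerNormalForm

open scoped BigOperators
open MvPolynomial

/-- **Fischer normal form in four variables, spelled out** (no local abbreviations): every
`P : MvPolynomial (Fin 4) ℝ` is `Σ_m (Σᵢ Xᵢ²)^{e_m} · H_m` with `H_m` homogeneous of degree `d_m` and
`Σᵢ ∂ᵢ² H_m = 0`.  Instance `ι = Fin 4` of
`Literature.Algebra.Polynomial.FischerDecomposition.exists_sum_sq_pow_mul_harmonic`.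
[cite: AxlerBourdonRamey2001, Thm. 5.7] -/
theorem fischerNormalForm_spelled (P : MvPolynomial (Fin 4) ℝ) :
    ∃ (M : ℕ) (H : Fin M → MvPolynomial (Fin 4) ℝ) (d e : Fin M → ℕ),
      (∀ m, (H m).IsHomogeneous (d m)) ∧
      (∀ m, (∑ i : Fin 4, pderiv i (pderiv i (H m))) = 0) ∧
      P = ∑ m, (∑ i : Fin 4, X i ^ 2) ^ (e m) * H m :=
  Literature.Algebra.Polynomial.FischerDecomposition.exists_sum_sq_pow_mul_harmonic P

/-! ## The skeleton's name-keyed statements, verbatim, and the registered stub -/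

/-- The polynomial Laplacian `Δ = Σᵢ ∂ᵢ²` on `ℝ[x₀, x₁, x₂, x₃]` (verbatim from the skeleton). -/
noncomputable def laplacian (P : MvPolynomial (Fin 4) ℝ) : MvPolynomial (Fin 4) ℝ :=
  ∑ i : Fin 4, MvPolynomial.pderiv i (MvPolynomial.pderiv i P)

/-- `P` is a harmonic polynomial: `ΔP = 0` (verbatim from the skeleton). -/
def IsHarmonicPoly (P : MvPolynomial (Fin 4) ℝ) : Prop :=
  laplacian P = 0

/-- `r² = Σᵢ xᵢ²` as a polynomial (verbatim from the skeleton). -/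
noncomputable def r2poly : MvPolynomial (Fin 4) ℝ :=
  ∑ i : Fin 4, MvPolynomial.X i ^ 2

/-- Stub «FISCHER NORMAL FORM» (verbatim from the skeleton; the registered obligation of LINE g18-A, a statement keyed by
name — NOT a Literature fact): every real polynomial in four variables is a finite sum `Σ_m (r²)^{e_m} · H_m` with `H_m`
harmonic and homogeneous (of degree `d_m`). -/
def FischerNormalForm : Prop :=
  ∀ P : MvPolynomial (Fin 4) ℝ,
    ∃ (M : ℕ) (H : Fin M → MvPolynomial (Fin 4) ℝ) (d e : Fin M → ℕ),
      (∀ m, (H m).IsHomogeneous (d m)) ∧ (∀ m, IsHarmonicPoly (H m)) ∧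
      P = ∑ m, r2poly ^ (e m) * H m

/-- **Registered stub `stub_fischerNormalForm` of LINE g18-A, BY NAME AND SIGNATURE**: the Fischer normal
form holds (the skeleton's `IsHarmonicPoly`/`laplacian`/`r2poly` unfold to the spelled-out statement
`fischerNormalForm_spelled` by `rfl`). [cite: AxlerBourdonRamey2001, Thm. 5.7] -/
theorem stub_fischerNormalForm : FischerNormalForm :=
  fun P => fischerNormalForm_spelled P

end Summit.QuantumFields.YangMills.Theorems.F4SubCurvatureDoorFischerNormalForm

end
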